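import Summits.KontsevichZagierPeriods.KontsevichZagierPeriods.Theorems.LinRedNormalFormWheelThreeSpokesCharts

/-!
# `WheelThreeSpokes` (stmt-KontsevichZagierPeriods-3913), line `laplacian-ldl-chart`:
compactification of the `d₃`-tail (`stub_tailChart`)

Third move of the chain. In the coordinates `y = (u, v, w, d₂, ·)` of the LDLᵀ chart put
`C := v(1−u−v) + w(1−w)d₂` and
`D5 = {0 < u, 0 < v, u + v < 1, uv < wd₂, u(1−u−v) < d₂(1−w), C < d₃}`,
`D5T = {0 < u, 0 < v, u + v < 1, uv < wd₂, u(1−u−v) < d₂(1−w), 0 < t < 1}`.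
On both domains `0 < w < 1` and `d₂ > 0` (hence `C > 0`): from `uv < wd₂` and
`u(1−u−v) < d₂(1−w)` both `wd₂` and `d₂(1−w)` are positive, so is their sum `d₂`.
The rational chart `(u, v, w, d₂, t) ↦ (u, v, w, d₂, C/t)` maps `D5T` bijectively onto `D5`
(inverse `t = C/d₃`), its Jacobian matrix is lower triangular with diagonal `(1,1,1,1,−C/t²)`,
and the pull-back of `1/(d₂d₃²)` is `1/(d₂(C/t)²)·C/t² = 1/(d₂C)`, free of the fibre variable
`t`. So ONE change of variables (Kontsevich–Zagier rule (2), `ratChart_transport`) gives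
`[D5T, 1/(d₂C)] ~ [D5, 1/(d₂d₃²)]`, with absolute integrability transported along the
chart. The chart is `Pᵢ/Qᵢ` with `P = (X₀, X₁, X₂, X₃, C)`, `Q = (1, 1, 1, 1, X₄)`, written out
in full in every statement below.

References: M. Kontsevich, D. Zagier, *Periods* (2001), §1.2 rule (2); J. Bochnak, M. Coste,
M.-F. Roy, *Real Algebraic Geometry* (1998), §2.2.
-/

noncomputable section

open Set MeasureTheory MvPolynomial
open Literature.NumberTheory.Transcendental
open Literature.ModelTheory.ExponentialFields (IsSemialgebraic isSemialgebraic_setOf_eval_lt)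

namespace Summit.KontsevichZagierPeriods.LinRedNormalForm.WheelThreeSpokes

namespace TailChart

/-- The little facts: on the base `{0 < u, 0 < v, u + v < 1, uv < wd₂, u(1−u−v) < d₂(1−w)}`
one has `0 < w < 1` and `0 < d₂` (`wd₂ > uv > 0` and `d₂(1−w) > u(1−u−v) > 0` add up to
`d₂ > 0`). [folklore] -/
theorem base_pos {u v w d : ℝ} (hu : 0 < u) (hv : 0 < v) (huv : u + v < 1) (h1 : u * v < w * d)
    (h2 : u * (1 - u - v) < d * (1 - w)) : 0 < w ∧ w < 1 ∧ 0 < d := by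
  have hwd : 0 < w * d := lt_trans (mul_pos hu hv) h1
  have hdw : 0 < d * (1 - w) := lt_trans (mul_pos hu (by linarith)) h2
  have hd : 0 < d := by nlinarith
  refine ⟨?_, ?_, hd⟩
  · by_contra hw
    push Not at hw
    nlinarith
  · by_contra hw
    push Not at hw
    nlinarith

/-- On the base, `C = v(1−u−v) + w(1−w)d₂ > 0`. [folklore] -/
theorem C_pos {u v w d : ℝ} (hu : 0 < u) (hv : 0 < v) (huv : u + v < 1) (h1 : u * v < w * d)
    (h2 : u * (1 - u - v) < d * (1 - w)) : 0 < v * (1 - u - v) + w * (1 - w) * d := by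
  obtain ⟨hw, hw1, hd⟩ := base_pos hu hv huv h1 h2
  have h3 : 0 < 1 - u - v := by linarith
  have h4 : 0 < 1 - w := by linarith
  positivity

/-- Values of the chart `(u, v, w, d₂, t) ↦ (u, v, w, d₂, C/t)`. [folklore] -/
theorem chart_apply (x : Fin 5 → ℝ) :
    (fun i => aeval x ((![X 0, X 1, X 2, X 3, X 1 * (1 - X 0 - X 1) + X 2 * (1 - X 2) * X 3] :
        Fin 5 → MvPolynomial (Fin 5) ℚ) i) /
        aeval x ((![1, 1, 1, 1, X 4] : Fin 5 → MvPolynomial (Fin 5) ℚ) i)) =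
      ![x 0, x 1, x 2, x 3, (x 1 * (1 - x 0 - x 1) + x 2 * (1 - x 2) * x 3) / x 4] := by
  funext i; fin_cases i <;> simp

/-- The chart maps `D5T` onto `D5` (`d₃ = C/t > C ⇔ t < 1`; inverse `t = C/d₃ ∈ (0,1)`).
[folklore] -/
theorem image_chart :
    (fun (x : Fin 5 → ℝ) (i : Fin 5) =>
        aeval x ((![X 0, X 1, X 2, X 3, X 1 * (1 - X 0 - X 1) + X 2 * (1 - X 2) * X 3] :
          Fin 5 → MvPolynomial (Fin 5) ℚ) i) /
        aeval x ((![1, 1, 1, 1, X 4] : Fin 5 → MvPolynomial (Fin 5) ℚ) i)) ''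
      {y : Fin 5 → ℝ | 0 < y 0 ∧ 0 < y 1 ∧ y 0 + y 1 < 1 ∧ y 0 * y 1 < y 2 * y 3 ∧
        y 0 * (1 - y 0 - y 1) < y 3 * (1 - y 2) ∧ 0 < y 4 ∧ y 4 < 1} =
      {y : Fin 5 → ℝ | 0 < y 0 ∧ 0 < y 1 ∧ y 0 + y 1 < 1 ∧ y 0 * y 1 < y 2 * y 3 ∧
        y 0 * (1 - y 0 - y 1) < y 3 * (1 - y 2) ∧
        y 1 * (1 - y 0 - y 1) + y 2 * (1 - y 2) * y 3 < y 4} := by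
  ext z
  constructor
  · rintro ⟨y, ⟨h0, h1, h2, h3, h4, h5, h6⟩, rfl⟩
    have hC := C_pos h0 h1 h2 h3 h4
    simp only [mem_setOf_eq, chart_apply, Matrix.cons_val_zero, Matrix.cons_val_one,
      Matrix.cons_val_two, Matrix.cons_val_three, Matrix.cons_val_four, Matrix.head_cons,
      Matrix.tail_cons]
    refine ⟨h0, h1, h2, h3, h4, ?_⟩
    rw [lt_div_iff₀ h5]
    exact mul_lt_of_lt_one_right hC h6
  · rintro ⟨h0, h1, h2, h3, h4, h5⟩
    have hC := C_pos h0 h1 h2 h3 h4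
    have hz4 : 0 < z 4 := lt_trans hC h5
    refine ⟨![z 0, z 1, z 2, z 3, (z 1 * (1 - z 0 - z 1) + z 2 * (1 - z 2) * z 3) / z 4],
      ?_, ?_⟩
    · simp only [mem_setOf_eq, Matrix.cons_val_zero, Matrix.cons_val_one, Matrix.cons_val_two,
        Matrix.cons_val_three, Matrix.cons_val_four, Matrix.head_cons, Matrix.tail_cons]
      refine ⟨h0, h1, h2, h3, h4, div_pos hC hz4, ?_⟩
      rw [div_lt_one hz4]
      exact h5
    · beta_reduce
      rw [chart_apply]
      funext i
      fin_cases i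
      · simp
      · simp
      · simp
      · simp
      · simp only [Matrix.cons_val_four, Matrix.head_cons, Matrix.tail_cons, Fin.isValue]
        show (z 1 * (1 - z 0 - z 1) + z 2 * (1 - z 2) * z 3) /
            ((z 1 * (1 - z 0 - z 1) + z 2 * (1 - z 2) * z 3) / z 4) = z 4
        field_simp

/-- The chart is injective on `D5T` (`t = C/d₃` is recovered, `C ≠ 0`). [folklore] -/
theorem injOn_chart :
    InjOn (fun (x : Fin 5 → ℝ) (i : Fin 5) =>
        aeval x ((![X 0, X 1, X 2, X 3, X 1 * (1 - X 0 - X 1) + X 2 * (1 - X 2) * X 3] :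
          Fin 5 → MvPolynomial (Fin 5) ℚ) i) /
        aeval x ((![1, 1, 1, 1, X 4] : Fin 5 → MvPolynomial (Fin 5) ℚ) i))
      {y : Fin 5 → ℝ | 0 < y 0 ∧ 0 < y 1 ∧ y 0 + y 1 < 1 ∧ y 0 * y 1 < y 2 * y 3 ∧
        y 0 * (1 - y 0 - y 1) < y 3 * (1 - y 2) ∧ 0 < y 4 ∧ y 4 < 1} := by
  intro x hx x' hx' h
  beta_reduce at h
  rw [chart_apply, chart_apply] at h
  have h0 := congrFun h 0
  have h1 := congrFun h 1
  have h2 := congrFun h 2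
  have h3 := congrFun h 3
  have h4 := congrFun h 4
  simp only [Matrix.cons_val_zero, Matrix.cons_val_one, Matrix.cons_val_two,
    Matrix.cons_val_three, Matrix.cons_val_four, Matrix.head_cons, Matrix.tail_cons]
    at h0 h1 h2 h3 h4
  obtain ⟨k0, k1, k2, k3, k4, k5, -⟩ := hx
  obtain ⟨-, -, -, -, -, k5', -⟩ := hx'
  have hC := C_pos k0 k1 k2 k3 k4
  rw [h0, h1, h2, h3] at h4 hC
  rw [div_eq_div_iff k5.ne' k5'.ne'] at h4
  have hx4 : x 4 = x' 4 := (mul_left_cancel₀ hC.ne' h4).symm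
  funext i
  fin_cases i
  · exact h0
  · exact h1
  · exact h2
  · exact h3
  · exact hx4

/-- Jacobian determinant of the chart: the matrix `((∂ⱼPᵢ)/Qᵢ − Pᵢ(∂ⱼQᵢ)/Qᵢ²)` is lower
triangular with diagonal `(1, 1, 1, 1, −C/t²)`. [folklore] -/
theorem det_chart (y : Fin 5 → ℝ) :
    (Matrix.of fun i j =>
        (aeval y ((![1, 1, 1, 1, X 4] : Fin 5 → MvPolynomial (Fin 5) ℚ) i))⁻¹ *
            aeval y (pderiv j ((![X 0, X 1, X 2, X 3,
              X 1 * (1 - X 0 - X 1) + X 2 * (1 - X 2) * X 3] :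
                Fin 5 → MvPolynomial (Fin 5) ℚ) i)) -
          aeval y ((![X 0, X 1, X 2, X 3, X 1 * (1 - X 0 - X 1) + X 2 * (1 - X 2) * X 3] :
              Fin 5 → MvPolynomial (Fin 5) ℚ) i) /
            aeval y ((![1, 1, 1, 1, X 4] : Fin 5 → MvPolynomial (Fin 5) ℚ) i) ^ 2 *
            aeval y (pderiv j ((![1, 1, 1, 1, X 4] : Fin 5 → MvPolynomial (Fin 5) ℚ) i)) :
        Matrix (Fin 5) (Fin 5) ℝ).det =
      aeval y (-(X 1 * (1 - X 0 - X 1) + X 2 * (1 - X 2) * X 3) : MvPolynomial (Fin 5) ℚ) /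
        aeval y (X 4 ^ 2 : MvPolynomial (Fin 5) ℚ) := by
  rw [Matrix.det_of_lowerTriangular _ ?_]
  · rw [Fin.prod_univ_five]
    simp
    ring
  · intro i j hij
    replace hij : i < j := hij
    fin_cases i <;> fin_cases j <;> simp at hij <;> simp

/-- Pull-back identity: `1/(d₂C) = 1/(d₂(C/t)²)·|−C/t²|` on `D5T`. [folklore] -/
theorem hgh_chart : ∀ y ∈ {y : Fin 5 → ℝ | 0 < y 0 ∧ 0 < y 1 ∧ y 0 + y 1 < 1 ∧
      y 0 * y 1 < y 2 * y 3 ∧ y 0 * (1 - y 0 - y 1) < y 3 * (1 - y 2) ∧ 0 < y 4 ∧ y 4 < 1},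
    (fun y : Fin 5 → ℝ => 1 / (y 3 * (y 1 * (1 - y 0 - y 1) + y 2 * (1 - y 2) * y 3))) y =
      (fun y : Fin 5 → ℝ => 1 / (y 3 * y 4 ^ 2)) (fun i =>
        aeval y ((![X 0, X 1, X 2, X 3, X 1 * (1 - X 0 - X 1) + X 2 * (1 - X 2) * X 3] :
          Fin 5 → MvPolynomial (Fin 5) ℚ) i) /
        aeval y ((![1, 1, 1, 1, X 4] : Fin 5 → MvPolynomial (Fin 5) ℚ) i)) *
        |aeval y (-(X 1 * (1 - X 0 - X 1) + X 2 * (1 - X 2) * X 3) : MvPolynomial (Fin 5) ℚ) /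
          aeval y (X 4 ^ 2 : MvPolynomial (Fin 5) ℚ)| := by
  rintro y ⟨h0, h1, h2, h3, h4, h5, -⟩
  obtain ⟨-, -, hd⟩ := base_pos h0 h1 h2 h3 h4
  have hC := C_pos h0 h1 h2 h3 h4
  rw [chart_apply]
  simp only [Matrix.cons_val_three, Matrix.cons_val_four, Matrix.head_cons, Matrix.tail_cons,
    map_neg, map_add, map_mul, map_sub, map_one, map_pow, aeval_X]
  rw [neg_div, abs_neg, abs_of_pos (div_pos hC (pow_pos h5 2))]
  field_simp

/-- `D5T` is `ℚ`-semialgebraic (seven strict polynomial inequalities).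
[cite: BochnakCosteRoy1998, Def. 2.1.4] -/
theorem isSemialgebraic_D5T : IsSemialgebraic ℚ {y : Fin 5 → ℝ | 0 < y 0 ∧ 0 < y 1 ∧
      y 0 + y 1 < 1 ∧ y 0 * y 1 < y 2 * y 3 ∧ y 0 * (1 - y 0 - y 1) < y 3 * (1 - y 2) ∧
      0 < y 4 ∧ y 4 < 1} := by
  have e0 := isSemialgebraic_setOf_eval_lt (k := ℚ) (R := ℝ) (0 : MvPolynomial (Fin 5) ℚ)
    (X 0)
  have e1 := isSemialgebraic_setOf_eval_lt (k := ℚ) (R := ℝ) (0 : MvPolynomial (Fin 5) ℚ)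
    (X 1)
  have e2 := isSemialgebraic_setOf_eval_lt (k := ℚ) (R := ℝ)
    (X 0 + X 1 : MvPolynomial (Fin 5) ℚ) 1
  have e3 := isSemialgebraic_setOf_eval_lt (k := ℚ) (R := ℝ)
    (X 0 * X 1 : MvPolynomial (Fin 5) ℚ) (X 2 * X 3)
  have e4 := isSemialgebraic_setOf_eval_lt (k := ℚ) (R := ℝ)
    (X 0 * (1 - X 0 - X 1) : MvPolynomial (Fin 5) ℚ) (X 3 * (1 - X 2))
  have e5 := isSemialgebraic_setOf_eval_lt (k := ℚ) (R := ℝ) (0 : MvPolynomial (Fin 5) ℚ)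
    (X 4)
  have e6 := isSemialgebraic_setOf_eval_lt (k := ℚ) (R := ℝ) (X 4 : MvPolynomial (Fin 5) ℚ)
    1
  simp only [map_zero, map_one, map_add, map_mul, map_sub, aeval_X] at e0 e1 e2 e3 e4 e5 e6
  simp only [Set.setOf_and]
  exact e0.inter (e1.inter (e2.inter (e3.inter (e4.inter (e5.inter e6)))))

end TailChart

open TailChart in
/-- **stub_tailChart**: compactification of the `d₃`-tail — ONE change of variables (rule 2)
along the rational chart `(u, v, w, d₂, t) ↦ (u, v, w, d₂, C/t)`,
`C = v(1−u−v) + w(1−w)d₂ > 0`, from `D5T` onto `D5`, `|J| = C/t²`, pulling `1/(d₂d₃²)` back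
to the `t`-free `1/(d₂C)`:
existence of the `D5T` representation from any `D5` one (integrability transported along the
chart) and the move `[D5T, 1/(d₂C)] ~ [D5, 1/(d₂d₃²)]` between any two such representations.
[cite: KontsevichZagier2001, §1.2 rule (2)] -/
theorem stub_tailChart :
    (∀ d : KZ.IntegralRep 5, d.domain = {y : Fin 5 → ℝ | 0 < y 0 ∧ 0 < y 1 ∧ y 0 + y 1 < 1 ∧ y 0 * y 1 < y 2 * y 3 ∧ y 0 * (1 - y 0 - y 1) < y 3 * (1 - y 2) ∧ y 1 * (1 - y 0 - y 1) + y 2 * (1 - y 2) * y 3 < y 4} →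
      Set.EqOn d.integrand (fun y => 1 / (y 3 * y 4 ^ 2)) d.domain →
      ∃ b : KZ.IntegralRep 5, b.domain = {y : Fin 5 → ℝ | 0 < y 0 ∧ 0 < y 1 ∧ y 0 + y 1 < 1 ∧ y 0 * y 1 < y 2 * y 3 ∧ y 0 * (1 - y 0 - y 1) < y 3 * (1 - y 2) ∧ 0 < y 4 ∧ y 4 < 1} ∧
        b.integrand = fun y => 1 / (y 3 * (y 1 * (1 - y 0 - y 1) + y 2 * (1 - y 2) * y 3))) ∧
    (∀ b d : KZ.IntegralRep 5, b.domain = {y : Fin 5 → ℝ | 0 < y 0 ∧ 0 < y 1 ∧ y 0 + y 1 < 1 ∧ y 0 * y 1 < y 2 * y 3 ∧ y 0 * (1 - y 0 - y 1) < y 3 * (1 - y 2) ∧ 0 < y 4 ∧ y 4 < 1} →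
      Set.EqOn b.integrand (fun y => 1 / (y 3 * (y 1 * (1 - y 0 - y 1) + y 2 * (1 - y 2) * y 3))) b.domain →
      d.domain = {y : Fin 5 → ℝ | 0 < y 0 ∧ 0 < y 1 ∧ y 0 + y 1 < 1 ∧ y 0 * y 1 < y 2 * y 3 ∧ y 0 * (1 - y 0 - y 1) < y 3 * (1 - y 2) ∧ y 1 * (1 - y 0 - y 1) + y 2 * (1 - y 2) * y 3 < y 4} →
      Set.EqOn d.integrand (fun y => 1 / (y 3 * y 4 ^ 2)) d.domain →
      KZ.Equivalent b d) := by
  have hQ : ∀ y ∈ {y : Fin 5 → ℝ | 0 < y 0 ∧ 0 < y 1 ∧ y 0 + y 1 < 1 ∧ y 0 * y 1 < y 2 * y 3 ∧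
      y 0 * (1 - y 0 - y 1) < y 3 * (1 - y 2) ∧ 0 < y 4 ∧ y 4 < 1}, ∀ i,
      aeval y ((![1, 1, 1, 1, X 4] : Fin 5 → MvPolynomial (Fin 5) ℚ) i) ≠ 0 := by
    rintro y ⟨-, -, -, -, -, h5, -⟩ i
    fin_cases i <;> simp [h5.ne']
  have hJQ : ∀ y ∈ {y : Fin 5 → ℝ | 0 < y 0 ∧ 0 < y 1 ∧ y 0 + y 1 < 1 ∧ y 0 * y 1 < y 2 * y 3 ∧
      y 0 * (1 - y 0 - y 1) < y 3 * (1 - y 2) ∧ 0 < y 4 ∧ y 4 < 1},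
      aeval y (X 4 ^ 2 : MvPolynomial (Fin 5) ℚ) ≠ 0 := by
    rintro y ⟨-, -, -, -, -, h5, -⟩
    simp [h5.ne']
  have hT := ratChart_transport
    (![X 0, X 1, X 2, X 3, X 1 * (1 - X 0 - X 1) + X 2 * (1 - X 2) * X 3] :
      Fin 5 → MvPolynomial (Fin 5) ℚ)
    (![1, 1, 1, 1, X 4] : Fin 5 → MvPolynomial (Fin 5) ℚ)
    (-(X 1 * (1 - X 0 - X 1) + X 2 * (1 - X 2) * X 3)) (X 4 ^ 2) isSemialgebraic_D5T hQ hJQ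
    (fun y _ => det_chart y) injOn_chart
    (fun y => 1 / (y 3 * (y 1 * (1 - y 0 - y 1) + y 2 * (1 - y 2) * y 3)))
    (fun y => 1 / (y 3 * y 4 ^ 2)) hgh_chart
  rw [image_chart] at hT
  obtain ⟨hT1, -, hT3⟩ := hT
  refine ⟨fun d hdd hdi => hT1 d hdd hdi, fun b d hbd hbi hdd hdi => ?_⟩
  exact hT3 b d hbd (fun y hy => hbi (by rw [hbd]; exact hy)) hdd hdi

end Summit.KontsevichZagierPeriods.LinRedNormalForm.WheelThreeSpokes
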